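import Literature.Computability.AlgebraicComplexity.Bur24UnboundedDegreeClasses
import Literature.Computability.AlgebraicComplexity.CoeffDefinable
import Literature.Computability.Complexity.CountingHierarchy
import Literature.Computability.Complexity.CircuitClasses
import HarnessLib

/-!
# Bürgisser 2026, §4: the algebraic counting class `VCH⁰`, its trailing-coefficient closure, and `VCH⁰` versus `VPnb⁰`

Topic `Literature/Computability/AlgebraicComplexity`. Source: P. Bürgisser, *Intractability of Hilbert's Nullstellensatz implies algebraic
hardness of permanent* (2026), arXiv:2606.25121, §4 "The complexity class `VCH⁰`"
(pp. 11–14 of the arXiv text). Key `Burgisser2026HNC`.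

The class `VCH⁰` (Def. 4.2, "implicitly in Koiran–Perifel 2011") consists of the families of
integer polynomials of *exponential format* (Def. 4.1: at most `p(n)` variables, degree and
coefficient bitsize at most `2^{p(n)}`) whose *coefficient function* — input `(1ⁿ, k, a)` with the
exponent vector `k` and the bit index `a` in binary, output the `a`-th bit of the coefficient
`c_n(k)`, the sign being bit `0` — lies in `CH/poly`; `VCH⁰(U)` is the uniform variant (`CH`).
This file states, over the tree's objects (`CH`, `polyAdvice`, `PPoly`, `IsVPnb0Family`,
`IsVNPnb0Family`, `IsVP0Family`, `IsVNP0Family`, the monomial code `encMonomial`):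

* `IsExpFormat` (Def. 4.1), `coeffFnBit`, `expCoeffQuery`, `HasCoeffFnIn K` (the coefficient
  function of a family as ONE language, queried on the code `⟨1ⁿ, ⟨code k, bin a⟩⟩`),
  `IsVCH0Family` / `IsUniformVCH0Family` (Def. 4.2);
* `tCoeff F i` (the coefficient of `tⁱ` of `F ∈ ℤ[t, x₁, …, x_u]`, `t` = variable `0`),
  `IsTrailingCoeff e F f` (`F = f tᵉ + t^{e+1} G`, `f ≠ 0`) and `IsVCH0BarFamily`
  (the class `\overline{VCH⁰}`, p. 12 before Cor. 4.4);
* NAMED FACTS (unproved here, used as hypotheses `(h : X)`): `Bur26_cor_4_3` (closure under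
  coefficient families, in the one-selected-variable form used by Cor. 4.4), `Bur26_cor_4_4`
  (`\overline{VCH⁰} ⊆ VCH⁰`), `Bur26_cor_4_10` (`VNPnb⁰ ⊆ VCH⁰`), `Bur26_cor_4_12`
  (`VP⁰ = VNP⁰ ⟹ CH ⊆ P/poly ∧ VCH⁰ ⊆ VPnb⁰`, the hypothesis rendered by the inclusion
  `VNP⁰ ⊆ VP⁰`, the inclusion `VP⁰ ⊆ VNP⁰` being a theorem, `IsVP0Family.isVNP0Family`);
* small proved consequences: `IsVPnb0Family.isVCH0Family_of` (`VPnb⁰ ⊆ VCH⁰` from Cor. 4.10),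
  `isVPnb0Family_of_isVCH0BarFamily` (under `VP⁰ = VNP⁰`, `\overline{VCH⁰} ⊆ VPnb⁰`: Cor. 4.4
  then Cor. 4.12), `IsExpFormat.isPBounded`.

## Rendering notes

* Families are indexed `f : ∀ n, MvPolynomial (Fin (v n)) ℤ` (the paper's `ℤ[x₁, …, x_{u(n)}]`);
  the classes `IsVPnb0Family`, … of the tree apply to `σ n = Fin (v n)` verbatim. We do NOT state
  the facts over arbitrary encodable variable types: the complexity of the coefficient language
  depends on the variable code, and only the canonical code of `Fin (v n)` (`Fin.encodable`,
  `encode i = i`) is polynomial-time equivalent to the paper's dense exponent vectors (for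
  `v` p-bounded; sparse/dense recoding, cf. the design notes of `CoeffDefinable.lean`).
* `n` is encoded in UNARY (`List.replicate n true`), as in the paper (`1ⁿ`, proof of Cor. 4.3,
  Def. 4.7): with `n` in binary a query about `f_n` may have length `O(log n)` and `CH/poly` could
  not supply `poly(n)` advice bits, so e.g. `VPnb⁰ ⊆ VCH⁰` (nonuniform circuits!) would fail.
* The coefficient function is ONE language `L` with `⟨1ⁿ, ⟨code k, bin 0⟩⟩ ∈ L ↔ c_n(k) < 0` and
  `⟨1ⁿ, ⟨code k, bin (a+1)⟩⟩ ∈ L ↔ bit a of |c_n(k)| = 1` ("the sign of `c_n(k)` is the `0`-th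
  bit", p. 11); off the query codes `L` is unconstrained (the `∃ L ∈ K` phrasing of
  `IsCoeffDefinableIn`).
* `\overline{VCH⁰}`: "there exists such a family `(F_n)` depending on an extra indeterminate `t`"
  is read as `(F_n) ∈ VCH⁰` in the variables `(t, x)` — the reading under which the printed proof
  of Cor. 4.4 ("immediate consequence of Cor. 4.3") applies; `t` is placed as variable `0` of
  `Fin (v n + 1)` and the `x`-variables as `Fin.succ i` (`MvPolynomial.finSuccEquiv`).
* Cor. 4.3 is stated for ONE distinguished variable `t` and the selection `ℓ(n) = e n`
  (coefficient of `t^{e n}`), the case invoked by Cor. 4.4; the general form (several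
  `y`-variables) is not needed in the tree.
* Cor. 4.12 is stated in its nonuniform first sentence; "`VP⁰ = VNP⁰`" is rendered by the
  inclusion `VNP⁰ ⊆ VP⁰` over the variable types `Fin (v n)`, and
  "`VPnb⁰ = VCH⁰`" by its non-trivial inclusion `VCH⁰ ⊆ VPnb⁰` (`VPnb⁰ ⊆ VCH⁰` is Cor. 4.10).
  Its printed proof uses `VP⁰ = VNP⁰ ⟹ PP ⊆ P/poly` [Bürgisser 2009], `CH ⊆ P/poly` (Lemma 2.5 of
  loc. cit., tree `CH_subset_PPoly_of_PP_subset_PPoly_holds`), Valiant's criterion and the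
  multilinear binary model `F_n` of Lemma 4.11 (`x_{i,j} ↦ x_i^{2^{j-1}}`, `y_ℓ ↦ 2^{2^{ℓ-1}}`).

No `instance`, no `notation`; statements only cite the arXiv text by corollary number and page.

## References

* P. Bürgisser, *Intractability of Hilbert's Nullstellensatz implies algebraic hardness of
  permanent*, arXiv:2606.25121 (2026): Def. 4.1, Def. 4.2, Cor. 4.3, `\overline{VCH⁰}` and Cor. 4.4 (p. 11–12), Def. 4.7,
  Prop. 4.8 (p. 12), Cor. 4.10, Lemma 4.11, Cor. 4.12 (pp. 13–14). Key `Burgisser2026HNC`.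
* P. Koiran, S. Perifel, *Interpolation in Valiant's theory*, Comput. Complexity 20 (2011) 1–20
  (the implicit source of Def. 4.2, Prop. 4.8). Key `KoiranPerifel2011`.
* P. Bürgisser, *Completeness classes in algebraic complexity theory*, arXiv:2406.06217 (2024),
  Def. 4.4 (`VPnb⁰`, `VNPnb⁰`; tree `Bur24UnboundedDegreeClasses.lean`). Key `Burgisser2024Completeness`.
-/

noncomputable section

open MvPolynomial _root_.Computability Literature.Computability.Complexity

namespace Literature.Computability.AlgebraicComplexity

/-! ### Def. 4.1–4.2: exponential format, coefficient function, `VCH⁰` -/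

section Defs

variable {v : ℕ → ℕ}

/-- **Bürgisser 2026, Def. 4.1: exponential format.** A family `(f_n)`, `f_n ∈ ℤ[x₁, …, x_{v n}]`,
is of exponential format if for some polynomially bounded `p`: the number of variables is at most
`p(n)`, and the degree and the bitsize of every coefficient of `f_n` are at most `2^{p(n)}`
(bitsize `≤ 2^{p n}` rendered as `|c| < 2^{2^{p n}}`). [cite: Burgisser2026HNC, Def. 4.1 (p. 11)] -/
def IsExpFormat (f : ∀ n, MvPolynomial (Fin (v n)) ℤ) : Prop :=
  ∃ p : ℕ → ℕ, IsPBounded p ∧ ∀ n, v n ≤ p n ∧ (f n).totalDegree ≤ 2 ^ p n ∧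
    ∀ e : Fin (v n) →₀ ℕ, (coeff e (f n)).natAbs < 2 ^ 2 ^ p n

/-- A family of exponential format has polynomially many variables. [cite: Burgisser2026HNC, Def. 4.1 (p. 11)] -/
theorem IsExpFormat.isPBounded {f : ∀ n, MvPolynomial (Fin (v n)) ℤ} (hf : IsExpFormat f) :
    IsPBounded v := by
  obtain ⟨p, hp, h⟩ := hf
  exact hp.mono fun n => (h n).1

/-- **The (total) coefficient function of one polynomial as a bit function** (Bürgisser 2026,
p. 11: input an exponent vector `k` and an index `a`, output "the `a`-th bit in the binary
expansion of `c_n(k)`, with the convention that the sign of `c_n(k)` is the `0`-th bit"):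
bit `0` is `true` iff the coefficient is negative, bit `a + 1` is bit `a` of `|c_n(k)|`
(`Nat.testBit`). [cite: Burgisser2026HNC, §4 (p. 11)] -/
def coeffFnBit {u : ℕ} (f : MvPolynomial (Fin u) ℤ) (e : Fin u →₀ ℕ) : ℕ → Bool
  | 0 => decide (coeff e f < 0)
  | a + 1 => (coeff e f).natAbs.testBit a

/-- The binary code of the coefficient query `(1ⁿ, k, a)`: `⟨1ⁿ, ⟨encMonomial k, bin a⟩⟩` with the
tree's pairing `boolPair`, `n` in unary (see the rendering notes), the exponent vector by the
tree's monomial code `encMonomial` (`CoeffDefinable.lean`) and `a` in binary (`encodeNat`).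
[cite: Burgisser2026HNC, §4 (p. 11), proof of Cor. 4.3 (`(1ⁿ, k, a)`)] -/
def expCoeffQuery (n : ℕ) {u : ℕ} (e : Fin u →₀ ℕ) (a : ℕ) : List Bool :=
  boolPair (List.replicate n true) (boolPair (encMonomial e) (encodeNat a))

/-- **"The coefficient function of `(f_n)` lies in the class `K`"** (`K = CH/poly`, `CH`,
`PSPACE/poly`, `P/poly`, …): some language of `K` answers every coefficient query
`⟨1ⁿ, ⟨code k, bin a⟩⟩` by the bit `coeffFnBit (f n) k a`. [cite: Burgisser2026HNC, Def. 4.2 (p. 11)] -/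
def HasCoeffFnIn (K : Set (Language Bool)) (f : ∀ n, MvPolynomial (Fin (v n)) ℤ) : Prop :=
  ∃ L ∈ K, ∀ (n : ℕ) (e : Fin (v n) →₀ ℕ) (a : ℕ), expCoeffQuery n e a ∈ L ↔ coeffFnBit (f n) e a = true

/-- Monotonicity of `HasCoeffFnIn` in the class. [cite: Burgisser2026HNC, Def. 4.2 (p. 11)] -/
theorem HasCoeffFnIn.mono {K K' : Set (Language Bool)} (hKK' : K ⊆ K')
    {f : ∀ n, MvPolynomial (Fin (v n)) ℤ} (h : HasCoeffFnIn K f) : HasCoeffFnIn K' f := by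
  obtain ⟨L, hL, h⟩ := h
  exact ⟨L, hKK' hL, h⟩

/-- **Bürgisser 2026, Def. 4.2: the algebraic counting class `VCH⁰`** — families of integer
polynomials of exponential format whose coefficient function is in `CH/poly`
(`polyAdvice CH`). [cite: Burgisser2026HNC, Def. 4.2 (p. 11)] -/
def IsVCH0Family (f : ∀ n, MvPolynomial (Fin (v n)) ℤ) : Prop :=
  IsExpFormat f ∧ HasCoeffFnIn (polyAdvice CH) f

/-- **Bürgisser 2026, Def. 4.2: the uniform class `VCH⁰(U)`** — coefficient function in `CH`.
[cite: Burgisser2026HNC, Def. 4.2 (p. 11)] -/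
def IsUniformVCH0Family (f : ∀ n, MvPolynomial (Fin (v n)) ℤ) : Prop :=
  IsExpFormat f ∧ HasCoeffFnIn CH f

/-- A `VCH⁰` family is of exponential format. [cite: Burgisser2026HNC, Def. 4.2 (p. 11)] -/
theorem IsVCH0Family.isExpFormat {f : ∀ n, MvPolynomial (Fin (v n)) ℤ} (hf : IsVCH0Family f) :
    IsExpFormat f :=
  hf.1

/-- `VCH⁰(U) ⊆ VCH⁰`, given the inclusion `CH ⊆ CH/poly` of the language classes (empty advice;
supplied as a hypothesis, cf. `P_subset_PPoly`-type lemmas of the tree). [cite: Burgisser2026HNC, Def. 4.2 (p. 11)] -/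
theorem IsUniformVCH0Family.isVCH0Family (hCH : CH ⊆ polyAdvice CH)
    {f : ∀ n, MvPolynomial (Fin (v n)) ℤ} (hf : IsUniformVCH0Family f) : IsVCH0Family f :=
  ⟨hf.1, hf.2.mono hCH⟩

end Defs

/-! ### `\overline{VCH⁰}`: trailing coefficients in an extra indeterminate `t` -/

section Closure

variable {v : ℕ → ℕ}

/-- The coefficient of `tⁱ` of `F ∈ ℤ[t, x₁, …, x_u]`, the indeterminate `t` being variable `0` of
`Fin (u + 1)` and `x_i` the variable `Fin.succ i` (`MvPolynomial.finSuccEquiv`).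
[cite: Burgisser2026HNC, §4 (p. 12, `F_n(x,t) = f_n(x) t^{e_n} + t^{e_n+1} G_n`)] -/
def tCoeff {u : ℕ} (F : MvPolynomial (Fin (u + 1)) ℤ) (i : ℕ) : MvPolynomial (Fin u) ℤ :=
  (finSuccEquiv ℤ u F).coeff i

/-- **`f` is the trailing coefficient of `F` in `t`, at order `e`**: `f ≠ 0`,
`F = f·tᵉ + t^{e+1}·G` — i.e. the `t`-coefficients of `F` below `e` vanish and the `e`-th is `f`
("`f_n = tc_t(F_n)`"; equivalently `f = lim_{τ → 0} τ^{-e} F(x, τ)`). [cite: Burgisser2026HNC, §4 (p. 12)] -/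
def IsTrailingCoeff {u : ℕ} (e : ℕ) (F : MvPolynomial (Fin (u + 1)) ℤ) (f : MvPolynomial (Fin u) ℤ) :
    Prop :=
  f ≠ 0 ∧ tCoeff F e = f ∧ ∀ i < e, tCoeff F i = 0

/-- **Bürgisser 2026, the class `\overline{VCH⁰}`** (p. 12): families `(f_n)` of exponential format
for which there are `(F_n) ∈ VCH⁰`, `F_n ∈ ℤ[t, x]`, and orders `e_n` with, for every `n`, either
`f_n = 0` or `F_n = f_n t^{e_n} + t^{e_n+1} G_n`, `f_n ≠ 0`. [cite: Burgisser2026HNC, §4 (p. 12)] -/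
def IsVCH0BarFamily (f : ∀ n, MvPolynomial (Fin (v n)) ℤ) : Prop :=
  IsExpFormat f ∧ ∃ (e : ℕ → ℕ) (F : ∀ n, MvPolynomial (Fin (v n + 1)) ℤ),
    IsVCH0Family F ∧ ∀ n, f n = 0 ∨ IsTrailingCoeff (e n) (F n) (f n)

end Closure

/-! ### Named facts: Cor. 4.3, Cor. 4.4, Cor. 4.10, Cor. 4.12 -/

section Facts

/-- **Bürgisser 2026, Cor. 4.3 (closure of `VCH⁰` under coefficient families; one selected
variable).** If `(F_n) ∈ VCH⁰`, `F_n ∈ ℤ[t, x]`, then for every selection `n ↦ e(n)` the family of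
coefficients of `t^{e(n)}` is in `VCH⁰` ("we can view the binary encoding of `ℓ(n)` as an advice
of polynomial length"). NAMED FACT, not proved here. [cite: Burgisser2026HNC, Cor. 4.3 (p. 11)] -/
def Bur26_cor_4_3 : Prop :=
  ∀ (v e : ℕ → ℕ) (F : ∀ n, MvPolynomial (Fin (v n + 1)) ℤ),
    IsVCH0Family F → IsVCH0Family fun n => tCoeff (F n) (e n)

/-- **Bürgisser 2026, Cor. 4.4: `\overline{VCH⁰} = VCH⁰`** ("a pleasant feature of `VCH⁰` is that
it coincides with its closure"), stated as the inclusion `\overline{VCH⁰} ⊆ VCH⁰` (the content;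
"immediate consequence of Cor. 4.3"). NAMED FACT, not proved here. [cite: Burgisser2026HNC, Cor. 4.4 (p. 12)] -/
def Bur26_cor_4_4 : Prop :=
  ∀ (v : ℕ → ℕ) (f : ∀ n, MvPolynomial (Fin (v n)) ℤ), IsVCH0BarFamily f → IsVCH0Family f

/-- **Bürgisser 2026, Cor. 4.10, first inclusion: `VNPnb⁰ ⊆ VCH⁰`** (from Thm. 3.9/Cor. 4.6, the
closure of `CH`-definability under exponential sums and products, and `BitSLP ∈ CH`
[Allender–Bürgisser–Kjeldgaard-Pedersen–Miltersen 2009]). NAMED FACT, not proved here.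
[cite: Burgisser2026HNC, Cor. 4.10 (p. 13)] -/
def Bur26_cor_4_10 : Prop :=
  ∀ (v : ℕ → ℕ) (f : ∀ n, MvPolynomial (Fin (v n)) ℤ), IsVNPnb0Family f → IsVCH0Family f

/-- **Bürgisser 2026, Cor. 4.12 (nonuniform part): `VP⁰ = VNP⁰` implies `CH ⊆ P/poly` and
`VPnb⁰ = VCH⁰`** (hypothesis rendered by its non-trivial inclusion `VNP⁰ ⊆ VP⁰` over the
variable types `Fin (v n)` — `VP⁰ ⊆ VNP⁰` holds, `IsVP0Family.isVNP0Family` —, conclusion by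
`VCH⁰ ⊆ VPnb⁰`; printed proof: `PP ⊆ P/poly`
[Bürgisser 2009], hence `CH ⊆ P/poly`; the multilinear binary model `F_n` of Lemma 4.11 has its
coefficient function in `CH/poly ⊆ P/poly`, so `(F_n) ∈ VNP⁰ = VP⁰` by Valiant's criterion, and
`f_n` is recovered from `F_n` by `x_{i,j} ↦ x_i^{2^{j-1}}`, `y_ℓ ↦ 2^{2^{ℓ-1}}`, repeated
squaring). NAMED FACT, not proved here. [cite: Burgisser2026HNC, Cor. 4.12 (p. 14)] -/
def Bur26_cor_4_12 : Prop :=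
  (∀ (v : ℕ → ℕ) (f : ∀ n, MvPolynomial (Fin (v n)) ℤ), IsVNP0Family f → IsVP0Family f) →
    CH ⊆ PPoly ∧
    ∀ (v : ℕ → ℕ) (f : ∀ n, MvPolynomial (Fin (v n)) ℤ), IsVCH0Family f → IsVPnb0Family f

end Facts

/-! ### Consequences -/

section Consequences

variable {v : ℕ → ℕ}

/-- `VPnb⁰ ⊆ VCH⁰` (Cor. 4.10 with `VPnb⁰ ⊆ VNPnb⁰`, `IsVPnb0Family.isVNPnb0Family`).
[cite: Burgisser2026HNC, Cor. 4.10 (p. 13)] -/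
theorem IsVPnb0Family.isVCH0Family_of (h410 : Bur26_cor_4_10) {f : ∀ n, MvPolynomial (Fin (v n)) ℤ}
    (hf : IsVPnb0Family f) : IsVCH0Family f :=
  h410 v f hf.isVNPnb0Family

/-- `VP⁰ ⊆ VCH⁰`. [cite: Burgisser2026HNC, Cor. 4.10 (p. 13)] -/
theorem IsVP0Family.isVCH0Family_of (h410 : Bur26_cor_4_10) {f : ∀ n, MvPolynomial (Fin (v n)) ℤ}
    (hf : IsVP0Family f) : IsVCH0Family f :=
  hf.isVPnb0Family.isVCH0Family_of h410

/-- **Under `VP⁰ = VNP⁰` the closure `\overline{VCH⁰}` lies in `VPnb⁰`**: Cor. 4.4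
(`\overline{VCH⁰} ⊆ VCH⁰`) followed by Cor. 4.12 (`VCH⁰ ⊆ VPnb⁰`). [cite: Burgisser2026HNC, Cor. 4.4 (p. 12), Cor. 4.12 (p. 14)] -/
theorem isVPnb0Family_of_isVCH0BarFamily (h44 : Bur26_cor_4_4) (h412 : Bur26_cor_4_12)
    (hEq : ∀ (w : ℕ → ℕ) (g : ∀ n, MvPolynomial (Fin (w n)) ℤ), IsVNP0Family g → IsVP0Family g)
    {f : ∀ n, MvPolynomial (Fin (v n)) ℤ} (hf : IsVCH0BarFamily f) :
    IsVPnb0Family f :=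
  (h412 hEq).2 v f (h44 v f hf)

/-- Under `VP⁰ = VNP⁰`, `CH ⊆ P/poly` (first clause of Cor. 4.12). [cite: Burgisser2026HNC, Cor. 4.12 (p. 14)] -/
theorem ch_subset_ppoly_of_vnp0_subset_vp0 (h412 : Bur26_cor_4_12)
    (hEq : ∀ (w : ℕ → ℕ) (g : ∀ n, MvPolynomial (Fin (w n)) ℤ), IsVNP0Family g → IsVP0Family g) :
    CH ⊆ PPoly :=
  (h412 hEq).1

/-- A `VCH⁰` family whose `t`-trailing coefficients are the `f_n` (where `f_n ≠ 0`) witnesses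
`f ∈ \overline{VCH⁰}` (definition unfolding, for use by summit-side files). [cite: Burgisser2026HNC, §4 (p. 12)] -/
theorem isVCH0BarFamily_intro {f : ∀ n, MvPolynomial (Fin (v n)) ℤ} (hf : IsExpFormat f)
    (e : ℕ → ℕ) (F : ∀ n, MvPolynomial (Fin (v n + 1)) ℤ) (hF : IsVCH0Family F)
    (hlim : ∀ n, f n = 0 ∨ IsTrailingCoeff (e n) (F n) (f n)) : IsVCH0BarFamily f :=
  ⟨hf, e, F, hF, hlim⟩

end Consequences

end Literature.Computability.AlgebraicComplexity

end
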